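import Summits.CriticalPhenomena.PercolationContinuityZ3.Theorems.FK.RegionLawMonotone
import Summits.CriticalPhenomena.PercolationContinuityZ3.Theorems.FK.UniquenessCriticalFKIsing
import HarnessLib

/-!
# FK-continuity cell, FO-10a: every local LIMIT POINT of box measures with arbitrary one-class boundary wirings
# `B_k ⊆ ∂Λ_{N_k}` is an infinite-volume random-cluster measure of the sandwich class `FKGibbs d p q`
# — such limit points EXIST (Thm. (4.17)(a), compactness) and lie in the sandwich (Thm. (4.19)(c) eq. (4.21) / (4.35))

Registered R104 (cell INBOX l.7098, 2026-08-24); registry row FO-10a-g340; label BCW-C (coordinator fk-4 g217).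
Cell `fk-continuity` (bschramm), row FO-10a (domain-Markov + boundary-condition comparison layer over FO-06); support file
for the FK-continuity transplant (`--supports stmt-CriticalPhenomena-4575`); builds on p205010 (kernel theorem, internal
audit signed; external expert review pending). Pure proofs; no definitions, no named facts, no sorries; general `d`.
UNCONDITIONAL infinite-volume structure; it decides nothing about FH / TP_FK / the value of `p_c(q)`.

Grimmett's set `W_{p,q}` of limit random-cluster measures consists of the weak limit points of `φ^ξ_{Λ,p,q}` over boxes
`Λ ↑ ℤ^d` and boundary conditions `ξ`; (4.21) sandwiches every member between `φ⁰_{p,q}` and `φ¹_{p,q}`, and Thm. (4.34)(b)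
does the same for the DLR measures. In the tree the sandwich is the CONDITIONAL interface `FKGibbs d p q P`
(`InfiniteVolumeGibbs`: `φ⁰_Λ(A) · P(H) ≤ P(A ∩ H) ≤ φ¹_Λ(A) · P(H)` for increasing `A ∈ 𝓕_Λ` and local `H` off `E_Λ`),
known for the two extreme limits `φ^b_{p,q}` (FO-06a `IsBoxLimit.fkGibbs`). Here, for `0 ≤ p ≤ 1`, `q ≥ 1`, ANY sequence
of boxes `Λ_{N_k}` with `N_k → ∞`, ANY wired classes `B_k ⊆ ∂Λ_{N_k}` (`boxBC d true (N_k)`), and a probability measure `P`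
with `φ^{B_k}_{Λ_{N_k},p,q}(A) → P(A)` for every local event `A` (`φ^B_Λ(A)` read as
`(rcMeasure (finsetGraph (zdGraph d) Λ) p q B).real (liftEdges Λ ⁻¹' A)`, edges off `Λ` closed):

* `rcMeasure_real_preimage_setOf_mem_eq_zero` — a non-lattice pair is a.s. closed under every `φ^B_Λ`;
  `ae_subset_edgeSet_of_tendsto_wiring` — hence `P`-a.s. only lattice bonds are open;
* `regionFreeReal_mul_le_of_tendsto_wiring`, `le_regionWiredReal_mul_of_tendsto_wiring` — the two conditional sandwich
  inequalities pass to the limit (FO-10a `RegionLawMonotone`: `regionFreeReal_mul_rcMeasure_region_le`,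
  `rcMeasure_region_le_regionWiredReal_mul` with `B_k ⊆ ∂Λ_{N_k} ⊆ envSet Λ Λ_{N_k}`);
* `exists_subseq_tendsto_of_isLocalEvent` (generic: probability measures on the configurations of a countable coordinate
  set are sequentially compact for convergence on local events — the cube `[0,1]^{Finset ι}` is compact),
  `exists_subseq_tendsto_wiring` — **Thm. (4.17)(a)**: every sequence of arbitrarily wired box measures has a locally
  convergent subsequence; with the next item, `exists_subseq_tendsto_wiring_fkGibbs` (a limit point in `FKGibbs d p q`);
* **`fkGibbs_of_tendsto_wiring`** — `FKGibbs d p q P`: EVERY SUCH LIMIT POINT IS A SANDWICH RANDOM-CLUSTER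
  MEASURE; consequently `φ⁰_{p,q}(A) ≤ P(A) ≤ φ¹_{p,q}(A)` on increasing local events
  (`rcLimit_false_real_le_of_tendsto_wiring`, `real_le_rcLimit_true_of_tendsto_wiring`), `P = φ⁰_{p,q}` whenever
  `φ⁰_{p,q} = φ¹_{p,q}` (`eq_rcLimit_false_of_tendsto_wiring_of_rcLimit_eq`), in particular when `θ¹(p,q) = 0`, and at the
  critical point of the FK–Ising model, `d ≥ 3`, `P = φ_{p_c(2),2}` and `P` does not percolate
  (`eq_rcLimit_false_of_tendsto_wiring_rcCriticalProb_two`, via FO-10a `UniquenessCriticalFKIsing`, ADS 2015).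

Honest framing: infinite-volume bookkeeping for the boundary conditions expressible in the tree (ONE wired class); no
statement about `p_c(q)`; NOT a binder discharge, NOT `_r4`.
Companions: `BoundaryWiringSandwich.lean` (full sequences, uniqueness iff wiring-insensitivity), `BoundaryWiringEdgeDensity.lean`.

## References

* G. Grimmett, *The Random-Cluster Model*, Springer 2006 (`book:grimmett2006-random-cluster-model`): Lemma (4.13),
  Lemma (4.14)(b), Thm. (4.17)(a), Thm. (4.19)(c) eq. (4.21), Thm. (4.34)(b) eq. (4.35), (4.36), Thm. (5.33)(a) [PDF pp. 74–78, 82–83, 107].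
  [Grimmett2006]
* M. Aizenman, H. Duminil-Copin, V. Sidoravicius, Comm. Math. Phys. 334 (2015) 719–742, Thm. 1.2, Cor. 1.5(1).
  [AizenmanDuminilCopinSidoraviciusCMP2015]
-/

noncomputable section

open MeasureTheory Set Filter Finset
open scoped Topology ENNReal

namespace Summit.CriticalPhenomena.PercolationContinuityZ3.Theorems.FK

open Literature.Probability.Percolation Literature.Probability.LatticeModels
open Literature.Barriers.CriticalPhenomena

variable {d : ℕ} {p q : ℝ}

/-! ### Support: only lattice bonds are open -/

/-- A non-lattice pair `e ∉ E(ℤ^d)` is almost surely closed under every finite-volume measure `φ^B_{Λ,p,q}` (read on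
`ℤ^d`): the measure lives on edge sets of the piece `(Λ, E_Λ)`. [cite: Grimmett2006, §4.2 (Ω = {0,1}^{𝔼^d})] -/
theorem rcMeasure_real_preimage_setOf_mem_eq_zero (hp : p ∈ Set.Icc (0 : ℝ) 1) (hq : 0 < q) (Λ : Finset (Site d))
    (B : Set ↥Λ) {e : Sym2 (Site d)} (he : e ∉ (zdGraph d).edgeSet) :
    (rcMeasure (finsetGraph (zdGraph d) Λ) p q B).real (liftEdges Λ ⁻¹' {ω | e ∈ ω}) = 0 := by
  set G := finsetGraph (zdGraph d) Λ
  have hsub : ∀ ω : BondConfig ↥Λ, ω ⊆ G.edgeSet → ω ∈ liftEdges Λ ⁻¹' {ω : BondConfig (Site d) | e ∈ ω} →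
      ω ∈ (∅ : Set (BondConfig ↥Λ)) := by
    intro ω hωE hω
    obtain ⟨e', he', rfl⟩ := mem_liftEdges_iff.1 hω
    apply he
    have h1 := hωE he'
    induction e' using Sym2.ind with
    | h a c => exact (SimpleGraph.mem_edgeSet _).2 ((SimpleGraph.mem_edgeSet _).1 h1)
  have h := rcMeasure_real_mono_on_edgeSets G hp hq B hsub
  rw [measureReal_empty] at h
  exact le_antisymm h measureReal_nonneg

/-! ### Existence of limit points (Grimmett 2006, Thm. (4.17)(a): compactness) -/

/-- **Sequential compactness of local laws** (the content of Grimmett's Thm. (4.17)(a), "any infinite family of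
probability measures on `Ω` is relatively compact"): every sequence of probability measures on the configurations of a
countable coordinate set has a subsequence converging on EVERY local event to some probability measure. Proof: the
vectors of increasing-cylinder probabilities live in the compact metrisable cube `[0,1]^{Finset ι}`; a convergent
subsequence there converges on all local events by inclusion–exclusion (FO-06 `exists_measure_tendsto_of_tendsto_supset`).
[cite: Grimmett2006, Thm. (4.17)(a), proof] -/
theorem exists_subseq_tendsto_of_isLocalEvent {ι : Type*} [Countable ι] (νs : ℕ → Measure (Set ι))
    [∀ n, IsProbabilityMeasure (νs n)] :
    ∃ φ : ℕ → ℕ, StrictMono φ ∧ ∃ P : Measure (Set ι), IsProbabilityMeasure P ∧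
      ∀ A : Set (Set ι), IsLocalEvent A → Tendsto (fun k => (νs (φ k)).real A) atTop (𝓝 (P.real A)) := by
  classical
  set v : ℕ → (Finset ι → ℝ) := fun n E₀ => (νs n).real {ω | (↑E₀ : Set ι) ⊆ ω} with hv
  have hS : IsCompact (Set.pi Set.univ fun _ : Finset ι => Set.Icc (0 : ℝ) 1) :=
    isCompact_univ_pi fun _ => isCompact_Icc
  have hvS : ∀ n, v n ∈ Set.pi Set.univ fun _ : Finset ι => Set.Icc (0 : ℝ) 1 := fun n E₀ _ =>
    ⟨measureReal_nonneg, measureReal_le_one⟩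
  obtain ⟨x, -, φ, hφ, hlim⟩ := hS.tendsto_subseq hvS
  refine ⟨φ, hφ, ?_⟩
  have hcyl : ∀ E₀ : Finset ι, ∃ r : ℝ,
      Tendsto (fun k => (νs (φ k)).real {ω | (↑E₀ : Set ι) ⊆ ω}) atTop (𝓝 r) := fun E₀ =>
    ⟨x E₀, (tendsto_pi_nhds.1 hlim E₀).congr fun k => rfl⟩
  obtain ⟨P, hP, hPt⟩ := exists_measure_tendsto_of_tendsto_supset (fun k => νs (φ k)) hcyl
  refine ⟨P, hP, fun A hA => ?_⟩
  have h := (ENNReal.tendsto_toReal (measure_ne_top P A)).comp (hPt A hA)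
  refine h.congr fun k => ?_
  simp only [Function.comp, measureReal_def]

/-- **Grimmett's Thm. (4.17)(a) for the boundary conditions of the tree**: for EVERY sequence of boxes `Λ_{N_k}` and wired
classes `B_k` there are a subsequence and a probability measure `P` on the configurations of `ℤ^d` such that
`φ^{B_{φ j}}_{Λ_{N_{φ j}},p,q}(A) → P(A)` for every local event `A` (`0 ≤ p ≤ 1`, `q > 0`).
[cite: Grimmett2006, Thm. (4.17)(a)] -/
theorem exists_subseq_tendsto_wiring (hp : p ∈ Set.Icc (0 : ℝ) 1) (hq : 0 < q) (Ns : ℕ → ℕ)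
    (B : ∀ k : ℕ, Set ↥(box d (Ns k))) :
    ∃ φ : ℕ → ℕ, StrictMono φ ∧ ∃ P : Measure (BondConfig (Site d)), IsProbabilityMeasure P ∧
      ∀ A : Set (BondConfig (Site d)), IsLocalEvent A →
        Tendsto (fun j => (rcMeasure (finsetGraph (zdGraph d) (box d (Ns (φ j)))) p q (B (φ j))).real
          (liftEdges (box d (Ns (φ j))) ⁻¹' A)) atTop (𝓝 (P.real A)) := by
  set ν : ℕ → Measure (BondConfig (Site d)) :=
    fun k => (rcMeasure (finsetGraph (zdGraph d) (box d (Ns k))) p q (B k)).map (liftEdges (box d (Ns k))) with hν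
  haveI : ∀ k, IsProbabilityMeasure (ν k) := fun k => by
    haveI := isProbabilityMeasure_rcMeasure (finsetGraph (zdGraph d) (box d (Ns k))) hp hq (B k)
    exact Measure.isProbabilityMeasure_map (measurable_liftEdges (box d (Ns k))).aemeasurable
  obtain ⟨φ, hφ, P, hP, hPt⟩ := exists_subseq_tendsto_of_isLocalEvent ν
  refine ⟨φ, hφ, P, hP, fun A hA => (hPt A hA).congr fun j => ?_⟩
  rw [hν, map_measureReal_apply (measurable_liftEdges (box d (Ns (φ j)))) (measurableSet_of_isLocalEvent_holds hA)]

section LimitPoint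

variable {Ns : ℕ → ℕ} {B : ∀ k : ℕ, Set ↥(box d (Ns k))} {P : Measure (BondConfig (Site d))}

/-- **Support of a limit point**: if `φ^{B_k}_{Λ_{N_k},p,q}(A) → P(A)` for every local event `A`, then `P`-almost surely
only lattice bonds are open. [cite: Grimmett2006, §4.2 (Ω = {0,1}^{𝔼^d}) with Thm. (4.19)(a)] -/
theorem ae_subset_edgeSet_of_tendsto_wiring [IsProbabilityMeasure P] (hp : p ∈ Set.Icc (0 : ℝ) 1) (hq : 0 < q)
    (hP : ∀ A : Set (BondConfig (Site d)), IsLocalEvent A →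
      Tendsto (fun k => (rcMeasure (finsetGraph (zdGraph d) (box d (Ns k))) p q (B k)).real
        (liftEdges (box d (Ns k)) ⁻¹' A)) atTop (𝓝 (P.real A))) :
    ∀ᵐ ω ∂P, ω ⊆ (zdGraph d).edgeSet := by
  refine ae_subset_of_measure_setOf_mem_eq_zero P _ fun e he => ?_
  have ht := hP _ (isLocalEvent_setOf_mem e)
  simp_rw [rcMeasure_real_preimage_setOf_mem_eq_zero hp hq _ _ he] at ht
  have h0 : P.real {ω | e ∈ ω} = 0 := tendsto_nhds_unique ht tendsto_const_nhds
  exact (measureReal_eq_zero_iff (measure_ne_top _ _)).1 h0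

/-- **Lower conditional sandwich in the limit**: for a finite region `Λ`, an increasing `A` determined by `E_Λ` and `H`
determined by a finite pair set disjoint from `E_Λ`, `φ⁰_{Λ,p,q}(A) · P(H) ≤ P(A ∩ H)` for every local limit point `P` of
arbitrarily wired box measures (`N_k → ∞`, any wired classes `B_k`). [cite: Grimmett2006, Lemma (4.13), Lemma (4.14)(b), Thm. (4.19)(c) eq. (4.21)] -/
theorem regionFreeReal_mul_le_of_tendsto_wiring (hp : p ∈ Set.Icc (0 : ℝ) 1) (hq : 1 ≤ q) (hNs : Tendsto Ns atTop atTop)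
    (hP : ∀ A : Set (BondConfig (Site d)), IsLocalEvent A →
      Tendsto (fun k => (rcMeasure (finsetGraph (zdGraph d) (box d (Ns k))) p q (B k)).real
        (liftEdges (box d (Ns k)) ⁻¹' A)) atTop (𝓝 (P.real A)))
    (Λ : Finset (Site d)) {A H : Set (BondConfig (Site d))} (T : Finset (Sym2 (Site d))) (hA : IsUpperSet A)
    (hAΛ : DeterminedBy A ↑(edgesIn (zdGraph d) Λ)) (hT : Disjoint (↑T : Set (Sym2 (Site d))) ↑(edgesIn (zdGraph d) Λ))
    (hH : DeterminedBy H ↑T) : regionFreeReal d p q Λ A * P.real H ≤ P.real (A ∩ H) := by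
  classical
  have hHl : IsLocalEvent H := ⟨T, hH⟩
  have hAl : IsLocalEvent A := ⟨_, hAΛ⟩
  refine le_of_tendsto_of_tendsto ((hP H hHl).const_mul _) (hP (A ∩ H) (hAl.inter hHl)) ?_
  filter_upwards [hNs.eventually (eventually_ge_atTop (Λ.sup siteRad))] with k hk
  exact regionFreeReal_mul_rcMeasure_region_le hp hq (subset_box_of_sup_siteRad_le hk) (B k) T hA hAΛ hT hH

/-- **Upper conditional sandwich in the limit**: with `Λ`, `A`, `H` as above and wired classes `B_k ⊆ ∂Λ_{N_k}`,
`P(A ∩ H) ≤ φ¹_{Λ,p,q}(A) · P(H)`. [cite: Grimmett2006, Lemma (4.13), Lemma (4.14)(b), Thm. (4.19)(c) eq. (4.21)] -/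
theorem le_regionWiredReal_mul_of_tendsto_wiring (hp : p ∈ Set.Icc (0 : ℝ) 1) (hq : 1 ≤ q) (hNs : Tendsto Ns atTop atTop)
    (hB : ∀ k, B k ⊆ boxBC d true (Ns k))
    (hP : ∀ A : Set (BondConfig (Site d)), IsLocalEvent A →
      Tendsto (fun k => (rcMeasure (finsetGraph (zdGraph d) (box d (Ns k))) p q (B k)).real
        (liftEdges (box d (Ns k)) ⁻¹' A)) atTop (𝓝 (P.real A)))
    (Λ : Finset (Site d)) {A H : Set (BondConfig (Site d))} (T : Finset (Sym2 (Site d))) (hA : IsUpperSet A)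
    (hAΛ : DeterminedBy A ↑(edgesIn (zdGraph d) Λ)) (hT : Disjoint (↑T : Set (Sym2 (Site d))) ↑(edgesIn (zdGraph d) Λ))
    (hH : DeterminedBy H ↑T) : P.real (A ∩ H) ≤ regionWiredReal d p q Λ A * P.real H := by
  classical
  have hHl : IsLocalEvent H := ⟨T, hH⟩
  have hAl : IsLocalEvent A := ⟨_, hAΛ⟩
  refine le_of_tendsto_of_tendsto (hP (A ∩ H) (hAl.inter hHl)) ((hP H hHl).const_mul _) ?_
  filter_upwards [hNs.eventually (eventually_ge_atTop (Λ.sup siteRad))] with k hk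
  have hΛ : Λ ⊆ box d (Ns k) := subset_box_of_sup_siteRad_le hk
  exact rcMeasure_region_le_regionWiredReal_mul hp hq hΛ
    ((hB k).trans (Literature.Probability.LatticeModels.wiredBoundary_subset_envSet hΛ)) T hA hAΛ hT hH

/-- **Every local limit point of arbitrarily wired box measures is a sandwich random-cluster measure**: if
`N_k → ∞`, `B_k ⊆ ∂Λ_{N_k}` and `φ^{B_k}_{Λ_{N_k},p,q}(A) → P(A)` for every local event `A` (`P` a probability measure,
`0 ≤ p ≤ 1`, `q ≥ 1`), then `FKGibbs d p q P`. [cite: Grimmett2006, Thm. (4.19)(c) eq. (4.21) and Thm. (4.34)(b) eq. (4.35)] -/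
theorem fkGibbs_of_tendsto_wiring [IsProbabilityMeasure P] (hp : p ∈ Set.Icc (0 : ℝ) 1) (hq : 1 ≤ q)
    (hNs : Tendsto Ns atTop atTop) (hB : ∀ k, B k ⊆ boxBC d true (Ns k))
    (hP : ∀ A : Set (BondConfig (Site d)), IsLocalEvent A →
      Tendsto (fun k => (rcMeasure (finsetGraph (zdGraph d) (box d (Ns k))) p q (B k)).real
        (liftEdges (box d (Ns k)) ⁻¹' A)) atTop (𝓝 (P.real A))) :
    FKGibbs d p q P where
  isProbabilityMeasure := ‹_›
  ae_subset_edgeSet := ae_subset_edgeSet_of_tendsto_wiring hp (one_pos.trans_le hq) hP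
  free_mul_le Λ _ _ T hA hAΛ hT hH := regionFreeReal_mul_le_of_tendsto_wiring hp hq hNs hP Λ T hA hAΛ hT hH
  le_wired_mul Λ _ _ T hA hAΛ hT hH := le_regionWiredReal_mul_of_tendsto_wiring hp hq hNs hB hP Λ T hA hAΛ hT hH

/-- Consequently `φ⁰_{p,q}(A) ≤ P(A)` for every increasing event `A` determined by the edges of a finite region.
[cite: Grimmett2006, Thm. (4.19)(c) eq. (4.21)] -/
theorem rcLimit_false_real_le_of_tendsto_wiring [IsProbabilityMeasure P] (hp : p ∈ Set.Icc (0 : ℝ) 1) (hq : 1 ≤ q)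
    (hNs : Tendsto Ns atTop atTop) (hB : ∀ k, B k ⊆ boxBC d true (Ns k))
    (hP : ∀ A : Set (BondConfig (Site d)), IsLocalEvent A →
      Tendsto (fun k => (rcMeasure (finsetGraph (zdGraph d) (box d (Ns k))) p q (B k)).real
        (liftEdges (box d (Ns k)) ⁻¹' A)) atTop (𝓝 (P.real A)))
    {A : Set (BondConfig (Site d))} {Λ : Finset (Site d)} (hA : IsUpperSet A)
    (hAΛ : DeterminedBy A ↑(edgesIn (zdGraph d) Λ)) : (rcLimit d false p q).real A ≤ P.real A :=
  (fkGibbs_of_tendsto_wiring hp hq hNs hB hP).isBoxLimit_real_le (isBoxLimit_rcLimit false hp hq) hA hAΛ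

/-- … and `P(A) ≤ φ¹_{p,q}(A)`. [cite: Grimmett2006, Thm. (4.19)(c) eq. (4.21)] -/
theorem real_le_rcLimit_true_of_tendsto_wiring [IsProbabilityMeasure P] (hp : p ∈ Set.Icc (0 : ℝ) 1) (hq : 1 ≤ q)
    (hNs : Tendsto Ns atTop atTop) (hB : ∀ k, B k ⊆ boxBC d true (Ns k))
    (hP : ∀ A : Set (BondConfig (Site d)), IsLocalEvent A →
      Tendsto (fun k => (rcMeasure (finsetGraph (zdGraph d) (box d (Ns k))) p q (B k)).real
        (liftEdges (box d (Ns k)) ⁻¹' A)) atTop (𝓝 (P.real A)))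
    {A : Set (BondConfig (Site d))} {Λ : Finset (Site d)} (hA : IsUpperSet A)
    (hAΛ : DeterminedBy A ↑(edgesIn (zdGraph d) Λ)) : P.real A ≤ (rcLimit d true p q).real A :=
  (fkGibbs_of_tendsto_wiring hp hq hNs hB hP).real_le_isBoxLimit (isBoxLimit_rcLimit true hp hq) hA hAΛ

/-- **At a point of uniqueness the limit point is `φ⁰_{p,q}`**: if moreover `φ⁰_{p,q} = φ¹_{p,q}` then `P = φ⁰_{p,q}`.
[cite: Grimmett2006, (4.36)] -/
theorem eq_rcLimit_false_of_tendsto_wiring_of_rcLimit_eq [IsProbabilityMeasure P] (hp : p ∈ Set.Icc (0 : ℝ) 1)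
    (hq : 1 ≤ q) (hNs : Tendsto Ns atTop atTop) (hB : ∀ k, B k ⊆ boxBC d true (Ns k))
    (hP : ∀ A : Set (BondConfig (Site d)), IsLocalEvent A →
      Tendsto (fun k => (rcMeasure (finsetGraph (zdGraph d) (box d (Ns k))) p q (B k)).real
        (liftEdges (box d (Ns k)) ⁻¹' A)) atTop (𝓝 (P.real A)))
    (huniq : rcLimit d false p q = rcLimit d true p q) : P = rcLimit d false p q :=
  (fkGibbs_of_tendsto_wiring hp hq hNs hB hP).eq_rcLimit_of_rcLimit_false_eq_true hp hq huniq

/-- … in particular when `θ¹(p,q) = 0` (non-percolating wired phase, e.g. `p < p_c(q)`; Grimmett's Thm. (5.33)(a)).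
[cite: Grimmett2006, Thm. (5.33)(a) with (4.36)] -/
theorem eq_rcLimit_false_of_tendsto_wiring_of_thetaWired_eq_zero [IsProbabilityMeasure P]
    (hp : p ∈ Set.Icc (0 : ℝ) 1) (hq : 1 ≤ q) (hNs : Tendsto Ns atTop atTop) (hB : ∀ k, B k ⊆ boxBC d true (Ns k))
    (hP : ∀ A : Set (BondConfig (Site d)), IsLocalEvent A →
      Tendsto (fun k => (rcMeasure (finsetGraph (zdGraph d) (box d (Ns k))) p q (B k)).real
        (liftEdges (box d (Ns k)) ⁻¹' A)) atTop (𝓝 (P.real A)))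
    (hθ : thetaWired d p q = 0) : P = rcLimit d false p q :=
  (fkGibbs_of_tendsto_wiring hp hq hNs hB hP).eq_rcLimit_false_of_thetaWired_eq_zero hp hq hθ

end LimitPoint

/-- **`W_{p,q} ≠ ∅` inside the sandwich class, for the boundary conditions of the tree** (Thm. (4.17)(a) with (4.21)): every
sequence of box measures `φ^{B_k}_{Λ_{N_k},p,q}` with `N_k → ∞` and wired classes `B_k ⊆ ∂Λ_{N_k}` has a subsequence
converging on all local events to a probability measure `P` with `FKGibbs d p q P` (`0 ≤ p ≤ 1`, `q ≥ 1`).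
[cite: Grimmett2006, Thm. (4.17)(a) and Thm. (4.19)(c) eq. (4.21)] -/
theorem exists_subseq_tendsto_wiring_fkGibbs (hp : p ∈ Set.Icc (0 : ℝ) 1) (hq : 1 ≤ q) {Ns : ℕ → ℕ}
    (hNs : Tendsto Ns atTop atTop) {B : ∀ k : ℕ, Set ↥(box d (Ns k))} (hB : ∀ k, B k ⊆ boxBC d true (Ns k)) :
    ∃ φ : ℕ → ℕ, StrictMono φ ∧ ∃ P : Measure (BondConfig (Site d)), FKGibbs d p q P ∧
      ∀ A : Set (BondConfig (Site d)), IsLocalEvent A →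
        Tendsto (fun j => (rcMeasure (finsetGraph (zdGraph d) (box d (Ns (φ j)))) p q (B (φ j))).real
          (liftEdges (box d (Ns (φ j))) ⁻¹' A)) atTop (𝓝 (P.real A)) := by
  obtain ⟨φ, hφ, P, hP, hPt⟩ := exists_subseq_tendsto_wiring hp (one_pos.trans_le hq) Ns B
  haveI := hP
  exact ⟨φ, hφ, P, fkGibbs_of_tendsto_wiring (Ns := fun j => Ns (φ j)) (B := fun j => B (φ j)) hp hq
    (hNs.comp hφ.tendsto_atTop) (fun j => hB (φ j)) hPt, hPt⟩


/-- **Critical FK–Ising model, `d ≥ 3`**: every local limit point `P` of critical box measures `φ^{B_k}_{Λ_{N_k},p_c(2),2}`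
with arbitrary wired classes `B_k ⊆ ∂Λ_{N_k}` IS the unique critical state `φ_{p_c(2),2}` and has almost surely no
infinite cluster. [cite: Grimmett2006, (4.36) with Conj. (5.34)(ii) at q = 2] [cite: AizenmanDuminilCopinSidoraviciusCMP2015, Thm. 1.2 with Cor. 1.5 (1)] -/
theorem eq_rcLimit_false_of_tendsto_wiring_rcCriticalProb_two (hd : 3 ≤ d) {Ns : ℕ → ℕ}
    {B : ∀ k : ℕ, Set ↥(box d (Ns k))} {P : Measure (BondConfig (Site d))} [IsProbabilityMeasure P]
    (hNs : Tendsto Ns atTop atTop) (hB : ∀ k, B k ⊆ boxBC d true (Ns k))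
    (hP : ∀ A : Set (BondConfig (Site d)), IsLocalEvent A →
      Tendsto (fun k => (rcMeasure (finsetGraph (zdGraph d) (box d (Ns k))) (rcCriticalProb d 2) 2 (B k)).real
        (liftEdges (box d (Ns k)) ⁻¹' A)) atTop (𝓝 (P.real A))) :
    P = rcLimit d false (rcCriticalProb d 2) 2 ∧ ∀ x : Site d, P.real (percolatesAt x) = 0 :=
  (fkGibbs_of_tendsto_wiring (rcCriticalProb_mem_Icc d 2) (by norm_num) hNs hB
    hP).eq_rcLimit_false_and_percolatesAt_rcCriticalProb_two hd

end Summit.CriticalPhenomena.PercolationContinuityZ3.Theorems.FK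

end
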